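import Mathlib

/-!
# `DivisionGap.PerMultiplesHard` (stmt-ValiantsHypothesis-5068), line `uncharged-face-walk`:
stub `stub_hybridRigidity` — a typed term containing a hybrid probe is rigid on the block

A HYBRID PROBE for the permutation `π` (mapping the column block `B` onto the row block `A`; `ζ` a
row shift preserving `A`; `bd ∈ B` the dump column) is an exponent `M` whose cells in the rows of
`A` are all of the form `(i, π⁻¹ i)` or `(i, π⁻¹ (ζ i))`, and whose cells in the columns of
`B ∖ {bd}` all lie in rows of `A`.  If `M` is an exponent of a typed product `a · b` (`a`
torus-homogeneous with row margins `ρ` and column margins `γ`), then `M = X + Y` with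
`X ∈ supp a` (`MvPolynomial.support_mul`, `Finset.mem_add`), `X ≤ M` pointwise, and the row /
column sums of `X` are `ρ` / `γ`; a nonzero row (column) of `X` inside the block therefore has a
nonzero cell of `M`, which is a probe cell.  This is the pattern of
`SpreadPatterns.spreadCompatible_of_probe` (p108487), localised to the block.

-- adapted from Summits/ValiantsHypothesis/ValiantsHypothesis/Theorems/DivisionGapPerMultiplesHardSpreadPatterns.lean
(`spreadCompatible_of_probe`)
-/

noncomputable section

-- `Summit.ValiantsHypothesis.ValiantsHypothesis.…` is the tree's mandated layout (Sub = Summit).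
set_option linter.dupNamespace false

namespace Summit.ValiantsHypothesis.ValiantsHypothesis.Theorems.DivisionGap.PerMultiplesHard.HybridRigidity

open MvPolynomial Finset
open scoped NNReal BigOperators

/-- **A nonzero cell forces a nonzero row margin.**  If the row sums of `X` are `ρ` and
`X (i, j) ≠ 0`, then `ρ i ≠ 0`. [folklore] -/
private theorem row_ne_zero_of_cell {n : ℕ} {X : (Fin n × Fin n) →₀ ℕ} {ρ : Fin n → ℕ}
    (hρ : ∀ i, ∑ j, X (i, j) = ρ i) {i j : Fin n} (hij : X (i, j) ≠ 0) : ρ i ≠ 0 := by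
  intro h0
  have h1 : X (i, j) ≤ ∑ j', X (i, j') :=
    Finset.single_le_sum (f := fun j' => X (i, j')) (fun _ _ => Nat.zero_le _) (Finset.mem_univ j)
  rw [hρ i, h0] at h1
  exact hij (Nat.eq_zero_of_le_zero h1)

/-- **A nonzero cell forces a nonzero column margin.**  If the column sums of `X` are `γ` and
`X (i, j) ≠ 0`, then `γ j ≠ 0`. [folklore] -/
private theorem col_ne_zero_of_cell {n : ℕ} {X : (Fin n × Fin n) →₀ ℕ} {γ : Fin n → ℕ}
    (hγ : ∀ j, ∑ i, X (i, j) = γ j) {i j : Fin n} (hij : X (i, j) ≠ 0) : γ j ≠ 0 := by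
  intro h0
  have h1 : X (i, j) ≤ ∑ i', X (i', j) :=
    Finset.single_le_sum (f := fun i' => X (i', j)) (fun _ _ => Nat.zero_le _) (Finset.mem_univ i)
  rw [hγ j, h0] at h1
  exact hij (Nat.eq_zero_of_le_zero h1)

/-- **stub_hybridRigidity — a typed term containing a hybrid probe is rigid on the block.**
Let `ζ` preserve `A`, `π(B) = A`, `bd` the dump column; let `a` be torus-homogeneous with margins
`(ρ, γ)` and `M ∈ supp (a · b)` a HYBRID PROBE for `π`: every cell of `M` in a row of `A` is
`(i, π⁻¹ i)` or `(i, π⁻¹ (ζ i))`, and every cell of `M` in a column of `B` other than `bd` lies in a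
row of `A`.  Then (H) every row `i ∈ A` hit by `a` (`ρ i ≠ 0`) has
`γ (π⁻¹ i) ≠ 0 ∨ γ (π⁻¹ (ζ i)) ≠ 0`, and (C) every column `j ∈ B`, `j ≠ bd`, hit by `a` (`γ j ≠ 0`)
has `ρ (π j) ≠ 0 ∨ ρ (ζ⁻¹ (π j)) ≠ 0`.  PROOF: `M = X + Y` with `X ∈ supp a`
(`MvPolynomial.support_mul`); a nonzero row `i ∈ A` of `X` has a cell `(i, j₀)`, nonzero in `M`,
hence a probe cell, and `γ j₀ ≥ X (i, j₀) > 0`; a nonzero column `j ∈ B ∖ {bd}` of `X` has a cell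
`(r, j)`, nonzero in `M`, so `r ∈ A`, hence `π j = r ∨ π j = ζ r`, and `ρ r > 0`; in the second
case `r = ζ⁻¹ (π j)`.  (The two structural hypotheses on `ζ` and `π` are not used.) [folklore] -/
theorem stub_hybridRigidity :
    ∀ (n : ℕ) (A B : Finset (Fin n)) (ζ π : Equiv.Perm (Fin n)) (bd : Fin n)
      (a b : MvPolynomial (Fin n × Fin n) ℝ≥0) (ρ γ : Fin n → ℕ) (M : (Fin n × Fin n) →₀ ℕ),
      (∀ i, ζ i ∈ A ↔ i ∈ A) → (∀ j, j ∈ B ↔ π j ∈ A) →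
      (∀ m ∈ a.support, (∀ i, ∑ j, m (i, j) = ρ i) ∧ (∀ j, ∑ i, m (i, j) = γ j)) →
      M ∈ (a * b).support →
      (∀ e ∈ M.support, e.1 ∈ A → (π e.2 = e.1 ∨ π e.2 = ζ e.1)) →
      (∀ e ∈ M.support, e.2 ∈ B → e.2 ≠ bd → e.1 ∈ A) →
      (∀ i ∈ A, ρ i ≠ 0 → (γ (π.symm i) ≠ 0 ∨ γ (π.symm (ζ i)) ≠ 0)) ∧
      (∀ j ∈ B, j ≠ bd → γ j ≠ 0 → (ρ (π j) ≠ 0 ∨ ρ (ζ.symm (π j)) ≠ 0)) := by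
  classical
  intro n A B ζ π bd a b ρ γ M _ _ hty hM hband hcol
  obtain ⟨X, hX, Y, -, hXY⟩ := Finset.mem_add.mp (MvPolynomial.support_mul a b hM)
  have hle : ∀ e, X e ≤ M e := fun e => by
    rw [← hXY, Finsupp.add_apply]; exact Nat.le_add_right _ _
  obtain ⟨hρ, hγ⟩ := hty X hX
  -- a nonzero cell of `X` is a nonzero cell of `M`
  have hsupp : ∀ e, X e ≠ 0 → e ∈ M.support := fun e he =>
    Finsupp.mem_support_iff.mpr (fun h0 => he (Nat.eq_zero_of_le_zero (h0 ▸ hle e)))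
  refine ⟨?_, ?_⟩
  · -- (H) hitting: a row `i ∈ A` with `ρ i ≠ 0` has a nonzero cell `(i, j₀)` of `X`, a probe cell
    intro i hiA hρi
    have hex : ∃ j, X (i, j) ≠ 0 := by
      by_contra hcon
      push Not at hcon
      exact hρi ((hρ i).symm.trans (Finset.sum_eq_zero fun j _ => hcon j))
    obtain ⟨j, hj⟩ := hex
    have hγj : γ j ≠ 0 := col_ne_zero_of_cell hγ hj
    rcases hband (i, j) (hsupp (i, j) hj) hiA with h1 | h2
    · left
      have h1' : π j = i := h1
      have : π.symm i = j := by rw [← h1']; exact π.symm_apply_apply j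
      rw [this]; exact hγj
    · right
      have h2' : π j = ζ i := h2
      have : π.symm (ζ i) = j := by rw [← h2']; exact π.symm_apply_apply j
      rw [this]; exact hγj
  · -- (C) images: a column `j ∈ B ∖ {bd}` with `γ j ≠ 0` has a nonzero cell `(r, j)` of `X`,
    -- which lies in a row `r ∈ A` and is therefore a probe cell
    intro j hjB hjbd hγj
    have hex : ∃ r, X (r, j) ≠ 0 := by
      by_contra hcon
      push Not at hcon
      exact hγj ((hγ j).symm.trans (Finset.sum_eq_zero fun r _ => hcon r))
    obtain ⟨r, hr⟩ := hex
    have hρr : ρ r ≠ 0 := row_ne_zero_of_cell hρ hr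
    have hrA : r ∈ A := hcol (r, j) (hsupp (r, j) hr) hjB hjbd
    rcases hband (r, j) (hsupp (r, j) hr) hrA with h1 | h2
    · left
      rw [show π j = r from h1]; exact hρr
    · right
      have h2' : π j = ζ r := h2
      have : ζ.symm (π j) = r := by rw [h2']; exact ζ.symm_apply_apply r
      rw [this]; exact hρr

end Summit.ValiantsHypothesis.ValiantsHypothesis.Theorems.DivisionGap.PerMultiplesHard.HybridRigidity

end
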